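import Literature.NumberTheory.Automorphic.FuchsianEisensteinConstantTerm
import Literature.Analysis.Complex.HolomorphicParametricIntegral

/-!
# Holomorphy of the Eisenstein series and of the scattering coefficients in `Re s > 1`
(Iwaniec, *Spectral Methods of Automorphic Forms*, GSM 53, §3.2 (3.11) & (3.20)–(3.22), PDF
pp. 43–46; §6.2 ("the analytic continuation of `E_𝔞(z, s)`", (6.15), "we also obtain the
meromorphic continuation of the coefficients `φ_𝔞𝔟(s)`"), PDF p. 85)

Eighth brick of the general-`Γ` Eisenstein series (`FuchsianGroupCusps` … `FuchsianEisensteinConstantTerm`)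
towards the general finite-volume cases of `Iwaniec2002_thm_7_4` / `Iwaniec2002_eq_12_5` /
`Iwaniec2002_thm_12_1`: the objects that Chapter 6 continues are HOLOMORPHIC on the half-plane
of absolute convergence, so that every statement about their continuations is a statement about
meromorphic functions agreeing with them on `Re s > 1` (identity theorem). For a discrete
`Γ ≤ SL₂(ℝ)` (inside `GL₂(ℝ)`) with the cusp `∞` of width one, resp. a system of cusps with
width-one scaling matrices; everything PROVED, nothing vendored, no fact introduced:

1. (§1) the domination `|(Im γz)^s| ≤ (Im γz)^{σ₀} + (Im γz)^{σ₁}` on vertical strips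
   `σ₀ ≤ Re s ≤ σ₁` (`norm_eisTerm_le_of_re_mem`);
2. (§2) **`s ↦ E_∞(z, s)` and `s ↦ E_𝔞(z, s)` are holomorphic on `{Re s > 1}`** for every `z`
   (`differentiableOn_eisInfty`, `differentiableOn_eisCusp`: Mathlib's
   `Complex.differentiableOn_tsum_of_summable_norm` on the strips, `summable_rowIm_rpow` twice);
3. (§3) **`(z, s) ↦ E_𝔞(z, s)` is jointly continuous on `ℍ × {Re s > 1}`**
   (`continuousOn_eisInfty₂`, `continuousOn_eisCusp₂`: uniform convergence on
   `B(z₀, 1) × {σ₀ < Re s < σ₁}` from the Harnack bound `norm_eisTerm_le_of_dist_le` and the joint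
   continuity of `(a, s) ↦ a^s`, Mathlib's `continuousAt_cpow`, `continuousOn_tsum`);
4. (§4) **the scattering coefficients `φᵢⱼ(s) = eisScattering Γ σ i j s` are holomorphic on
   `{Re s > 1}`** (`differentiableOn_eisScattering`, `continuousOn_eisScattering`): a dominated
   parameter integral of the holomorphic family `s ↦ E_𝔞ᵢ(σⱼ(x + i), s)`, `x ∈ [0, 1]`, by
   `Literature.Analysis.Complex.differentiableOn_integral_of_dominated` (no derivative bounds
   needed; the majorant is a constant from 3 on the compact `[0, 1] × B̄(s₀, R)`).

## References
* [Iwaniec2002] H. Iwaniec, *Spectral Methods of Automorphic Forms*, 2nd ed., GSM 53, AMS 2002,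
  §3.2, PDF pp. 43–46; §6.2, PDF p. 85 (held copy `book:iwaniec2002-spectral-methods-automorphic-forms`).

Mathlib: `Complex.differentiableOn_tsum_of_summable_norm`, `continuousOn_tsum`, `continuousAt_cpow`,
`DifferentiableAt.const_cpow`, `Real.rpow_le_rpow_of_exponent_ge/le`, `IsCompact.exists_bound_of_continuousOn`.
Literature: `Literature.Analysis.Complex.differentiableOn_integral_of_dominated`
(`Analysis/Complex/HolomorphicParametricIntegral`); `eisTerm`, `eisInfty`, `eisCusp`, `norm_eisTerm`,
`norm_eisTerm_le_of_dist_le` (`FuchsianEisensteinSeries`); `summable_rowIm_rpow`, `rowIm_pos`,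
`conj_le_range`, `IsDiscreteSubgroup.conj` (`FuchsianGroupCusps`); `continuous_rowIm`
(`FuchsianIncompleteEisenstein`); `eisScattering`, `cuspMeanAt_apply` (`FuchsianEisensteinConstantTerm`,
`FuchsianCuspidalSubspace`); `continuous_vadd₂` (`CuspidalSubspace`); `upperRightHom_one_mem_of_periods`
(`FuchsianCuspZones`). Nothing on holomorphy in `s` of Eisenstein series of a general group existed
(`lean search 'differentiableOn_eis|continuousOn_eisInfty|holomorph.*Eisenstein.*Fuchsian'`; the modular
files continue `E(z, s)` for `SL₂(ℤ)` explicitly).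
-/

noncomputable section

namespace Literature.NumberTheory.Automorphic

open Matrix UpperHalfPlane
open scoped MatrixGroups

namespace Fuchsian

variable {Γ : Subgroup (GL (Fin 2) ℝ)}

/-! ## 1. Uniform bounds for the terms on vertical strips -/

section Bounds

open _root_.Set

/-- `a^t ≤ a^{σ₀} + a^{σ₁}` for `a > 0` and `σ₀ ≤ t ≤ σ₁`. [folklore] -/
theorem rpow_le_rpow_add_rpow {a : ℝ} (ha : 0 < a) {σ₀ σ₁ t : ℝ} (h0 : σ₀ ≤ t) (h1 : t ≤ σ₁) :
    a ^ t ≤ a ^ σ₀ + a ^ σ₁ := by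
  have hp0 : 0 ≤ a ^ σ₀ := by positivity
  have hp1 : 0 ≤ a ^ σ₁ := by positivity
  rcases le_or_gt a 1 with hle | hgt
  · have := Real.rpow_le_rpow_of_exponent_ge ha hle h0
    linarith
  · have := Real.rpow_le_rpow_of_exponent_le hgt.le h1
    linarith

/-- `‖(Im_r z)^s‖ ≤ (Im_r z)^{σ₀} + (Im_r z)^{σ₁}` for `σ₀ ≤ Re s ≤ σ₁`. [folklore] -/
theorem norm_eisTerm_le_of_re_mem {r : Fin 2 → ℝ} (hr : r ≠ 0) (z : ℍ) {s : ℂ} {σ₀ σ₁ : ℝ}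
    (h0 : σ₀ ≤ s.re) (h1 : s.re ≤ σ₁) :
    ‖eisTerm s r z‖ ≤ rowIm r z ^ σ₀ + rowIm r z ^ σ₁ := by
  rw [norm_eisTerm hr]
  exact rpow_le_rpow_add_rpow (rowIm_pos hr z) h0 h1

/-- The open vertical strip `{σ₀ < Re s < σ₁}`. [folklore] -/
theorem isOpen_reStrip (σ₀ σ₁ : ℝ) : IsOpen {s : ℂ | σ₀ < s.re ∧ s.re < σ₁} :=
  (isOpen_lt continuous_const Complex.continuous_re).inter (isOpen_lt Complex.continuous_re continuous_const)

end Bounds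

/-! ## 2. Holomorphy of `s ↦ E_𝔞(z, s)` in `Re s > 1` -/

section Holomorphy

open _root_.Set
open scoped _root_.Pointwise

/-- **`s ↦ E_∞(z, s)` is holomorphic in `Re s > 1`** for every `z` (the series of holomorphic
terms `(Im γz)^s` converges uniformly on vertical strips `1 < σ₀ ≤ Re s ≤ σ₁`, dominated by
`(Im γz)^{σ₀} + (Im γz)^{σ₁}`). [cite: Iwaniec2002, §3.2 & §6.2 ("analytic continuation"), PDF pp. 43, 85] -/
theorem differentiableOn_eisInfty
    (hΓ : Γ ≤ (Matrix.SpecialLinearGroup.toGL : SL(2, ℝ) →* GL (Fin 2) ℝ).range)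
    (hd : IsDiscreteSubgroup Γ) (hT : Matrix.GeneralLinearGroup.upperRightHom (1 : ℝ) ∈ Γ) (z : ℍ) :
    DifferentiableOn ℂ (fun s => eisInfty Γ z s) {s : ℂ | 1 < s.re} := by
  intro s₀ hs₀
  have hs₀' : 1 < s₀.re := hs₀
  set σ₀ : ℝ := (1 + s₀.re) / 2 with hσ₀
  set σ₁ : ℝ := s₀.re + 1 with hσ₁
  have hσ₀1 : 1 < σ₀ := by rw [hσ₀]; linarith
  have hσ₁1 : 1 < σ₁ := by rw [hσ₁]; linarith
  set U : Set ℂ := {s : ℂ | σ₀ < s.re ∧ s.re < σ₁} with hU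
  have hUo : IsOpen U := isOpen_reStrip σ₀ σ₁
  have hs₀U : s₀ ∈ U := ⟨by show σ₀ < s₀.re; rw [hσ₀]; linarith, by show s₀.re < σ₁; rw [hσ₁]; linarith⟩
  have hdiff : DifferentiableOn ℂ (fun s => eisInfty Γ z s) U := by
    unfold eisInfty
    refine DifferentiableOn.const_mul ?_ _
    refine Complex.differentiableOn_tsum_of_summable_norm
      (u := fun r : rows Γ => rowIm r.1 z ^ σ₀ + rowIm r.1 z ^ σ₁) ?_ ?_ hUo ?_
    · exact (summable_rowIm_rpow hΓ hd hT z hσ₀1).add (summable_rowIm_rpow hΓ hd hT z hσ₁1)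
    · intro r s _
      unfold eisTerm
      refine (differentiableAt_id.const_cpow (Or.inl ?_)).differentiableWithinAt
      exact_mod_cast (rowIm_pos (ne_zero_of_mem_rows r.2) z).ne'
    · intro r s hs
      exact norm_eisTerm_le_of_re_mem (ne_zero_of_mem_rows r.2) z hs.1.le hs.2.le
  exact (hdiff.differentiableAt (hUo.mem_nhds hs₀U)).differentiableWithinAt

/-- **`s ↦ E_𝔞(z, s)` is holomorphic in `Re s > 1`** (`σ⁻¹Γσ ∋ T_1`). [cite: Iwaniec2002, §3.2, PDF p. 43] -/
theorem differentiableOn_eisCusp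
    (hΓ : Γ ≤ (Matrix.SpecialLinearGroup.toGL : SL(2, ℝ) →* GL (Fin 2) ℝ).range)
    (hd : IsDiscreteSubgroup Γ) (σ : SL(2, ℝ))
    (hT : Matrix.GeneralLinearGroup.upperRightHom (1 : ℝ) ∈
      ConjAct.toConjAct (Matrix.SpecialLinearGroup.toGL σ : GL (Fin 2) ℝ)⁻¹ • Γ) (z : ℍ) :
    DifferentiableOn ℂ (fun s => eisCusp Γ σ z s) {s : ℂ | 1 < s.re} := by
  have hle : ConjAct.toConjAct (Matrix.SpecialLinearGroup.toGL σ : GL (Fin 2) ℝ)⁻¹ • Γ ≤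
      (Matrix.SpecialLinearGroup.toGL : SL(2, ℝ) →* GL (Fin 2) ℝ).range := by
    rw [← map_inv]; exact conj_le_range hΓ σ⁻¹
  exact differentiableOn_eisInfty hle (hd.conj _) hT (σ⁻¹ • z)

end Holomorphy

/-! ## 3. Joint continuity of `(z, s) ↦ E_𝔞(z, s)` -/

section JointContinuity

open _root_.Set
open scoped _root_.Pointwise

/-- **`(z, s) ↦ E_∞(z, s)` is continuous on `ℍ × {Re s > 1}`** (uniform convergence on
`B(z₀, 1) × {σ₀ < Re s < σ₁}` by the Harnack bound `Im γw ≤ e^{ρ(w,z₀)} Im γz₀`). [cite: Iwaniec2002, §3.2, PDF p. 43] -/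
theorem continuousOn_eisInfty₂
    (hΓ : Γ ≤ (Matrix.SpecialLinearGroup.toGL : SL(2, ℝ) →* GL (Fin 2) ℝ).range)
    (hd : IsDiscreteSubgroup Γ) (hT : Matrix.GeneralLinearGroup.upperRightHom (1 : ℝ) ∈ Γ) :
    ContinuousOn (fun p : ℍ × ℂ => eisInfty Γ p.1 p.2) ((Set.univ : Set ℍ) ×ˢ {s : ℂ | 1 < s.re}) := by
  rintro ⟨z₀, s₀⟩ ⟨-, hs₀⟩
  have hs₀' : 1 < s₀.re := hs₀
  set σ₀ : ℝ := (1 + s₀.re) / 2 with hσ₀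
  set σ₁ : ℝ := s₀.re + 1 with hσ₁
  have hσ₀1 : 1 < σ₀ := by rw [hσ₀]; linarith
  have hσ₁1 : 1 < σ₁ := by rw [hσ₁]; linarith
  set U : Set ℂ := {s : ℂ | σ₀ < s.re ∧ s.re < σ₁} with hU
  have hUo : IsOpen U := isOpen_reStrip σ₀ σ₁
  have hs₀U : s₀ ∈ U := ⟨by show σ₀ < s₀.re; rw [hσ₀]; linarith, by show s₀.re < σ₁; rw [hσ₁]; linarith⟩
  set V : Set (ℍ × ℂ) := Metric.ball z₀ 1 ×ˢ U with hV
  have hVo : IsOpen V := Metric.isOpen_ball.prod hUo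
  have hpV : (z₀, s₀) ∈ V := ⟨Metric.mem_ball_self one_pos, hs₀U⟩
  have hcont : ContinuousOn (fun p : ℍ × ℂ => eisInfty Γ p.1 p.2) V := by
    unfold eisInfty
    refine continuousOn_const.mul ?_
    refine continuousOn_tsum
      (u := fun r : rows Γ => Real.exp σ₁ * (rowIm r.1 z₀ ^ σ₀ + rowIm r.1 z₀ ^ σ₁)) (fun r => ?_) ?_ ?_
    · -- each term is jointly continuous
      intro p _
      unfold eisTerm
      have hr := ne_zero_of_mem_rows r.2
      have h1 : ContinuousAt (fun p : ℍ × ℂ => ((((rowIm r.1 p.1 : ℝ) : ℂ)), p.2)) p :=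
        ((Complex.continuous_ofReal.comp ((continuous_rowIm hr).comp continuous_fst)).prodMk
          continuous_snd).continuousAt
      have h2 : ContinuousAt (fun x : ℂ × ℂ => x.1 ^ x.2) ((((rowIm r.1 p.1 : ℝ) : ℂ)), p.2) :=
        continuousAt_cpow (Complex.ofReal_mem_slitPlane.mpr (rowIm_pos hr p.1))
      exact (ContinuousAt.comp (f := fun p : ℍ × ℂ => ((((rowIm r.1 p.1 : ℝ) : ℂ)), p.2)) h2 h1).continuousWithinAt
    · exact ((summable_rowIm_rpow hΓ hd hT z₀ hσ₀1).add (summable_rowIm_rpow hΓ hd hT z₀ hσ₁1)).mul_left _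
    · rintro r ⟨w, s⟩ ⟨hw, hs⟩
      have hsre : 0 ≤ s.re := by linarith [hs.1]
      have h := norm_eisTerm_le_of_dist_le hΓ r.2 hsre (R := 1) (Metric.mem_ball.mp hw).le
      refine h.trans ?_
      rw [one_mul]
      have he : Real.exp s.re ≤ Real.exp σ₁ := Real.exp_le_exp.mpr hs.2.le
      have hb := rpow_le_rpow_add_rpow (rowIm_pos (ne_zero_of_mem_rows r.2) z₀) hs.1.le hs.2.le
      have h0 : 0 ≤ rowIm r.1 z₀ ^ s.re := Real.rpow_nonneg (rowIm_nonneg _ _) _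
      calc Real.exp s.re * rowIm r.1 z₀ ^ s.re ≤ Real.exp σ₁ * rowIm r.1 z₀ ^ s.re :=
            mul_le_mul_of_nonneg_right he h0
        _ ≤ Real.exp σ₁ * (rowIm r.1 z₀ ^ σ₀ + rowIm r.1 z₀ ^ σ₁) :=
            mul_le_mul_of_nonneg_left hb (Real.exp_pos _).le
  exact (hcont.continuousAt (hVo.mem_nhds hpV)).continuousWithinAt

/-- The same for `E_𝔞` through a scaling matrix. [cite: Iwaniec2002, §3.2, PDF p. 43] -/
theorem continuousOn_eisCusp₂
    (hΓ : Γ ≤ (Matrix.SpecialLinearGroup.toGL : SL(2, ℝ) →* GL (Fin 2) ℝ).range)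
    (hd : IsDiscreteSubgroup Γ) (σ : SL(2, ℝ))
    (hT : Matrix.GeneralLinearGroup.upperRightHom (1 : ℝ) ∈
      ConjAct.toConjAct (Matrix.SpecialLinearGroup.toGL σ : GL (Fin 2) ℝ)⁻¹ • Γ) :
    ContinuousOn (fun p : ℍ × ℂ => eisCusp Γ σ p.1 p.2) ((Set.univ : Set ℍ) ×ˢ {s : ℂ | 1 < s.re}) := by
  have hle : ConjAct.toConjAct (Matrix.SpecialLinearGroup.toGL σ : GL (Fin 2) ℝ)⁻¹ • Γ ≤
      (Matrix.SpecialLinearGroup.toGL : SL(2, ℝ) →* GL (Fin 2) ℝ).range := by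
    rw [← map_inv]; exact conj_le_range hΓ σ⁻¹
  have h := continuousOn_eisInfty₂ hle (hd.conj _) hT
  have hmap : ContinuousOn (fun p : ℍ × ℂ => (σ⁻¹ • p.1, p.2)) ((Set.univ : Set ℍ) ×ˢ {s : ℂ | 1 < s.re}) :=
    (((continuous_const_smul σ⁻¹).comp continuous_fst).prodMk continuous_snd).continuousOn
  have hmaps : MapsTo (fun p : ℍ × ℂ => (σ⁻¹ • p.1, p.2)) ((Set.univ : Set ℍ) ×ˢ {s : ℂ | 1 < s.re})
      ((Set.univ : Set ℍ) ×ˢ {s : ℂ | 1 < s.re}) := fun p hp => ⟨mem_univ _, hp.2⟩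
  have e : (fun p : ℍ × ℂ => eisCusp Γ σ p.1 p.2) =
      (fun p : ℍ × ℂ => eisInfty (ConjAct.toConjAct (Matrix.SpecialLinearGroup.toGL σ : GL (Fin 2) ℝ)⁻¹ • Γ) p.1 p.2) ∘
        (fun p : ℍ × ℂ => (σ⁻¹ • p.1, p.2)) := rfl
  rw [e]
  exact h.comp hmap hmaps

end JointContinuity

/-! ## 4. Holomorphy of the scattering coefficients `φᵢⱼ(s)` in `Re s > 1` -/

section Scattering

open _root_.Set _root_.MeasureTheory _root_.Filter
open scoped _root_.Pointwise

variable {h : ℕ} {σ : Fin h → SL(2, ℝ)}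

/-- **`s ↦ φᵢⱼ(s)` is holomorphic in `Re s > 1`** (a dominated parameter integral of the
holomorphic family `s ↦ E_𝔞ᵢ(σⱼ(x + i), s)`, `x ∈ [0, 1]`:
`Literature.Analysis.Complex.differentiableOn_integral_of_dominated`, the majorant being a
constant from joint continuity on `[0,1] × B̄(s₀, R)`). [cite: Iwaniec2002, §3.2 (3.20)–(3.22) & §6.2, PDF pp. 46, 85] -/
theorem differentiableOn_eisScattering
    (hΓ : Γ ≤ (Matrix.SpecialLinearGroup.toGL : SL(2, ℝ) →* GL (Fin 2) ℝ).range)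
    (hd : IsDiscreteSubgroup Γ)
    (hper : ∀ i, (ConjAct.toConjAct (Matrix.SpecialLinearGroup.toGL (σ i) : GL (Fin 2) ℝ)⁻¹ • Γ).strictPeriods =
      AddSubgroup.zmultiples 1) (i j : Fin h) :
    DifferentiableOn ℂ (eisScattering Γ σ i j) {s : ℂ | 1 < s.re} := by
  set U : Set ℂ := {s : ℂ | 1 < s.re} with hU
  have hUo : IsOpen U := isOpen_lt continuous_const Complex.continuous_re
  have hT : Matrix.GeneralLinearGroup.upperRightHom (1 : ℝ) ∈
      ConjAct.toConjAct (Matrix.SpecialLinearGroup.toGL (σ i) : GL (Fin 2) ℝ)⁻¹ • Γ :=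
    upperRightHom_one_mem_of_periods (hper i)
  -- the integrand `F s x = E_𝔞ᵢ(σⱼ(x +ᵥ i), s)`
  set pt : ℝ → ℍ := fun x => σ j • ((x : ℝ) +ᵥ UpperHalfPlane.I) with hpt
  have hptc : Continuous pt := (continuous_const_smul (σ j)).comp
    (continuous_vadd₂.comp (continuous_id.prodMk continuous_const))
  set F : ℂ → ℝ → ℂ := fun s x => eisCusp Γ (σ i) (pt x) s with hF
  have hE2 := continuousOn_eisCusp₂ hΓ hd (σ i) hT
  have hint : DifferentiableOn ℂ (fun s => ∫ x, F s x ∂(volume.restrict (Ioc (0 : ℝ) 1))) U := by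
    refine Literature.Analysis.Complex.differentiableOn_integral_of_dominated ?_ ?_ ?_
    · -- measurability in `x`
      intro s hs
      have hc : Continuous fun x => F s x := by
        have h1 : ContinuousOn (fun x : ℝ => (pt x, s)) univ := (hptc.prodMk continuous_const).continuousOn
        have h2 := hE2.comp h1 (fun x _ => ⟨mem_univ _, hs⟩)
        have e : (fun x => F s x) = (fun p : ℍ × ℂ => eisCusp Γ (σ i) p.1 p.2) ∘ (fun x : ℝ => (pt x, s)) := rfl
        rw [e]
        exact continuousOn_univ.mp h2
      exact hc.aestronglyMeasurable
    · -- holomorphy in `s`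
      exact Eventually.of_forall fun x => differentiableOn_eisCusp hΓ hd (σ i) hT (pt x)
    · -- domination on balls by a constant
      intro s₀ hs₀
      have hs₀' : 1 < s₀.re := hs₀
      set R : ℝ := (s₀.re - 1) / 2 with hR
      have hRpos : 0 < R := by rw [hR]; linarith
      have hball : Metric.closedBall s₀ R ⊆ U := by
        intro s hs
        rw [Metric.mem_closedBall] at hs
        have h1 : |s.re - s₀.re| ≤ ‖s - s₀‖ := by
          simpa [Complex.sub_re] using Complex.abs_re_le_norm (s - s₀)
        rw [dist_eq_norm] at hs
        show 1 < s.re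
        have := abs_le.mp (h1.trans hs)
        rw [hR] at this
        linarith [this.1]
      -- continuity on the compact `[0,1] × B̄(s₀, R)` gives a bound
      have hK : IsCompact (Icc (0 : ℝ) 1 ×ˢ Metric.closedBall s₀ R) :=
        isCompact_Icc.prod (isCompact_closedBall s₀ R)
      have hcK : ContinuousOn (fun q : ℝ × ℂ => F q.2 q.1) (Icc (0 : ℝ) 1 ×ˢ Metric.closedBall s₀ R) := by
        have h1 : ContinuousOn (fun q : ℝ × ℂ => (pt q.1, q.2)) (Icc (0 : ℝ) 1 ×ˢ Metric.closedBall s₀ R) :=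
          ((hptc.comp continuous_fst).prodMk continuous_snd).continuousOn
        have e : (fun q : ℝ × ℂ => F q.2 q.1) =
            (fun p : ℍ × ℂ => eisCusp Γ (σ i) p.1 p.2) ∘ (fun q : ℝ × ℂ => (pt q.1, q.2)) := rfl
        rw [e]
        exact hE2.comp h1 fun q hq => ⟨mem_univ _, hball hq.2⟩
      obtain ⟨C, hC⟩ := hK.exists_bound_of_continuousOn hcK
      refine ⟨R, hRpos, (Metric.ball_subset_closedBall).trans hball, fun _ => C, integrable_const C, ?_⟩
      filter_upwards [ae_restrict_mem measurableSet_Ioc] with x hx s hs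
      exact hC (x, s) ⟨⟨hx.1.le, hx.2⟩, Metric.ball_subset_closedBall hs⟩
  have e : eisScattering Γ σ i j = fun s =>
      (∫ x, F s x ∂(volume.restrict (Ioc (0 : ℝ) 1))) - if i = j then 1 else 0 := by
    funext s
    rw [eisScattering, cuspMeanAt_apply, intervalIntegral.integral_of_le zero_le_one]
  rw [e]
  exact hint.sub_const _

/-- … hence continuous there. [folklore] -/
theorem continuousOn_eisScattering
    (hΓ : Γ ≤ (Matrix.SpecialLinearGroup.toGL : SL(2, ℝ) →* GL (Fin 2) ℝ).range)
    (hd : IsDiscreteSubgroup Γ)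
    (hper : ∀ i, (ConjAct.toConjAct (Matrix.SpecialLinearGroup.toGL (σ i) : GL (Fin 2) ℝ)⁻¹ • Γ).strictPeriods =
      AddSubgroup.zmultiples 1) (i j : Fin h) :
    ContinuousOn (eisScattering Γ σ i j) {s : ℂ | 1 < s.re} :=
  (differentiableOn_eisScattering hΓ hd hper i j).continuousOn

end Scattering

end Fuchsian

end Literature.NumberTheory.Automorphic

end
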